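import Literature.Analysis.FunctionSpaces.TorusAxisAverage
import Mathlib.MeasureTheory.Integral.IntervalIntegral.Periodic
import Mathlib.Analysis.Fourier.AddCircle
import HarnessLib

/-!
# Line integrals along one coordinate of the flat torus: the real-parameter shear and the Fourier
# coefficients of weighted line averages

Analysis/FunctionSpaces support file (everything proved; no definitions, no named facts; global
`volume` convention of `FlatTorus`, statements through `UnitAddTorus.mFourierCoeff`). Tools for
reading an `L¹` function on `T^d = (ℝ/ℤ)^d` along the lines `τ ↦ x + τ𝐞ₚ`
(`𝐞ₚ τ = Pi.single p (τ : ℝ/ℤ)`, real parameter `τ`), as used by the absolutely-continuous-on-lines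
representative of `TorusLineAbsContinuity`:

* `Torus.measurePreserving_add_single_coe` — the shear `(x, τ) ↦ x + τ𝐞ₚ` is measure preserving
  from `T^d × (0, 1]` onto `T^d` (the tree's `Torus.measurePreserving_add_single_prod` composed with
  Mathlib's `UnitAddCircle.measurePreserving_mk`); hence (`Torus.ae_intervalIntegrable_comp_add_single`)
  **for `f ∈ L¹(T^d)` and a.e. `x`, the `1`-periodic line function `τ ↦ f(x + τ𝐞ₚ)` is integrable on
  every bounded interval** (Fubini for one period, `Function.Periodic.intervalIntegrable₀`);
* `Torus.mFourierCoeff_lineAvg` — for continuous `w : ℝ → ℂ`,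
  `𝓕(x ↦ ∫₀¹ w(τ) f(x + τ𝐞ₚ) dτ)(n) = (∫₀¹ w(τ) e^{2πi nₚ τ} dτ) f̂(n)` (Fubini and
  `𝓕(f(· + τ𝐞ₚ))(n) = e^{2πi nₚ τ} f̂(n)`, Grafakos 2014, Prop. 3.1.2 (5)), with the two scalar
  integrals `∫₀¹ e^{2πimτ} dτ = 𝟙[m = 0]` and `∫₀¹ τ e^{2πimτ} dτ = (2πim)⁻¹` (`m ≠ 0`);
* `Literature.Analysis.FunctionSpaces.intervalIntegral_avgPrimitive_eq` — for a `1`-periodic pair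
  `(g, h)` on `ℝ`, `h` locally integrable with `∫₀¹ h = 0`, the averaged primitive
  `G(t) = ∫₀¹ g(τ + t) dτ + ∫₀¹ τ h(τ + t) dτ` satisfies `G(t) = G(0) + ∫₀ᵗ h` (interval-integral
  algebra).

## Mathlib / tree search

Mathlib: `UnitAddCircle.measurePreserving_mk`, `Function.Periodic.intervalIntegrable₀`,
`Function.Periodic.intervalIntegral_add_eq`, `hasDerivAt_fourier`, `MeasureTheory.integral_integral_swap`;
no line/axis averages with a real parameter. Tree: `Torus.measurePreserving_add_single_prod`,
`Torus.mFourierCoeff_comp_add_single`, `Torus.axisAvg` (circle parameter; `TorusAxisAverage`),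
`Torus.mFourierCoeff_add` (`TorusSobolevNormFacts`).

## References

* L. Grafakos, *Classical Fourier Analysis*, 3rd ed. (2014), Prop. 3.1.2 (5). [Grafakos2014]
-/

noncomputable section

open MeasureTheory Set Filter Function intervalIntegral UnitAddTorus Complex
open scoped ENNReal NNReal Topology

namespace Literature.Analysis.FunctionSpaces

/-! ## The averaged primitive of a periodic pair on the real line -/

section RealLine

variable {F : Type*} [NormedAddCommGroup F] [NormedSpace ℂ F]

/-- **The averaged primitive.** Let `g, h : ℝ → F` be `1`-periodic, `h` integrable on every bounded
interval with `∫₀¹ h = 0` (no integrability of `g` is needed: its average is translation invariant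
even as a junk value). Then `G(t) := ∫₀¹ g(τ + t) dτ + ∫₀¹ τ • h(τ + t) dτ` satisfies
`G(t) = G(0) + ∫₀ᵗ h` for every real `t`: `∫₀¹ g(τ + t) dτ = ∫₀¹ g` by periodicity, and
`∫₀¹ τ h(τ + t) dτ = ∫ₜ^{t+1} σ h(σ) dσ - t ∫ₜ^{t+1} h = ∫₀¹ σ h(σ) dσ + ∫₀ᵗ h`, because
`∫₁^{1+t} σ h(σ) dσ = ∫₀ᵗ (σ + 1) h(σ) dσ`. [folklore] -/
theorem intervalIntegral_avgPrimitive_eq {g h : ℝ → F} (hg : Periodic g 1) (hh : Periodic h 1)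
    (hhi : ∀ a b, IntervalIntegrable h volume a b) (hΛ : ∫ τ in (0 : ℝ)..1, h τ = 0) (t : ℝ) :
    (∫ τ in (0 : ℝ)..1, g (τ + t)) + ∫ τ in (0 : ℝ)..1, ((τ : ℝ) : ℂ) • h (τ + t) =
      ((∫ τ in (0 : ℝ)..1, g τ) + ∫ τ in (0 : ℝ)..1, ((τ : ℝ) : ℂ) • h τ) +
        ∫ τ in (0 : ℝ)..t, h τ := by
  -- the weighted function `k σ = σ • h σ`
  set k : ℝ → F := fun σ => ((σ : ℝ) : ℂ) • h σ with hk
  have hki : ∀ a b, IntervalIntegrable k volume a b := fun a b =>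
    (hhi a b).continuousOn_smul continuous_ofReal.continuousOn
  -- periodic shifts of `g` and `h`
  have h1 : ∫ τ in (0 : ℝ)..1, g (τ + t) = ∫ τ in (0 : ℝ)..1, g τ := by
    rw [intervalIntegral.integral_comp_add_right, zero_add, add_comm,
      hg.intervalIntegral_add_eq t 0, zero_add]
  have h2 : ∫ τ in t..t + 1, h τ = 0 := by
    rw [hh.intervalIntegral_add_eq t 0, zero_add]; exact hΛ
  -- `∫ₜ^{t+1} k = ∫₀¹ k + ∫₀ᵗ h`
  have h3 : ∫ σ in t..t + 1, k σ = (∫ σ in (0 : ℝ)..1, k σ) + ∫ σ in (0 : ℝ)..t, h σ := by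
    have hsplit1 : ∫ σ in t..t + 1, k σ = (∫ σ in t..(0 : ℝ), k σ) + ∫ σ in (0 : ℝ)..t + 1, k σ :=
      (integral_add_adjacent_intervals (hki _ _) (hki _ _)).symm
    have hsplit2 : ∫ σ in (0 : ℝ)..t + 1, k σ =
        (∫ σ in (0 : ℝ)..1, k σ) + ∫ σ in (1 : ℝ)..t + 1, k σ :=
      (integral_add_adjacent_intervals (hki _ _) (hki _ _)).symm
    have hshift : ∫ σ in (1 : ℝ)..t + 1, k σ = (∫ σ in (0 : ℝ)..t, k σ) + ∫ σ in (0 : ℝ)..t, h σ := by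
      have hc : ∫ σ in (0 : ℝ)..t, k (σ + 1) = ∫ σ in (1 : ℝ)..t + 1, k σ := by
        rw [intervalIntegral.integral_comp_add_right, zero_add]
      have hk1 : ∀ σ, k (σ + 1) = k σ + h σ := fun σ => by
        simp only [hk, hh σ, Complex.ofReal_add, Complex.ofReal_one, add_smul, one_smul]
      rw [← hc]
      simp_rw [hk1]
      exact integral_add (hki _ _) (hhi _ _)
    rw [hsplit1, hsplit2, hshift, integral_symm t 0]
    abel
  -- the weighted shift: `∫₀¹ τ h(τ + t) dτ = ∫ₜ^{t+1} k - t ∫ₜ^{t+1} h`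
  have h4 : ∫ τ in (0 : ℝ)..1, ((τ : ℝ) : ℂ) • h (τ + t) =
      (∫ σ in t..t + 1, k σ) - ((t : ℝ) : ℂ) • ∫ σ in t..t + 1, h σ := by
    have hpt : ∀ τ : ℝ, ((τ : ℝ) : ℂ) • h (τ + t) = k (τ + t) - ((t : ℝ) : ℂ) • h (τ + t) := by
      intro τ
      simp only [hk, Complex.ofReal_add, add_smul]
      abel
    simp_rw [hpt]
    have hk' : IntervalIntegrable (fun τ => k (τ + t)) volume 0 1 := by
      simpa using (hki (0 + t) (1 + t)).comp_add_right t
    have hh0 : IntervalIntegrable (fun τ => h (τ + t)) volume 0 1 := by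
      simpa using (hhi (0 + t) (1 + t)).comp_add_right t
    have hh' : IntervalIntegrable (fun τ => ((t : ℝ) : ℂ) • h (τ + t)) volume 0 1 :=
      hh0.continuousOn_smul continuousOn_const
    rw [intervalIntegral.integral_sub hk' hh', intervalIntegral.integral_smul,
      intervalIntegral.integral_comp_add_right, intervalIntegral.integral_comp_add_right h, zero_add,
      add_comm (1 : ℝ) t]
  rw [h1, h4, h2, smul_zero, sub_zero, h3]
  abel

end RealLine

namespace Torus

variable {d : Type*} [Fintype d] [DecidableEq d]

/-! ## The shear `(x, τ) ↦ x + τ𝐞ₚ` with a real parameter -/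

section Shear

omit [Fintype d] in
/-- The line point `τ ↦ x + τ𝐞ₚ` is `1`-periodic in the real parameter. [folklore] -/
theorem periodic_comp_add_single {β : Type*} (f : UnitAddTorus d → β) (p : d) (x : UnitAddTorus d) :
    Periodic (fun τ : ℝ => f (x + Pi.single p ((τ : ℝ) : UnitAddCircle))) 1 := fun τ => by
  simp only [AddCircle.coe_add_period]

omit [Fintype d] in
/-- Additivity of the line points: `x + t𝐞ₚ + τ𝐞ₚ = x + (τ + t)𝐞ₚ`. [folklore] -/
theorem add_single_add_single (p : d) (x : UnitAddTorus d) (t τ : ℝ) :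
    x + Pi.single p ((t : ℝ) : UnitAddCircle) + (Pi.single p ((τ : ℝ) : UnitAddCircle) : UnitAddTorus d) =
      x + Pi.single p ((τ + t : ℝ) : UnitAddCircle) := by
  rw [add_assoc, ← Pi.single_add, AddCircle.coe_add, add_comm (τ : UnitAddCircle)]

variable {F : Type*} [NormedAddCommGroup F]

/-- **The shear `(x, τ) ↦ x + τ𝐞ₚ` is measure preserving from `T^d × (0, 1]` onto `T^d`**
(the tree's `Torus.measurePreserving_add_single_prod` composed with the measure-preserving
covering map `(0,1] → ℝ/ℤ`, Mathlib `UnitAddCircle.measurePreserving_mk`). [folklore] -/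
theorem measurePreserving_add_single_coe (p : d) :
    MeasurePreserving (fun z : UnitAddTorus d × ℝ => z.1 + Pi.single p ((z.2 : ℝ) : UnitAddCircle))
      ((volume : Measure (UnitAddTorus d)).prod (volume.restrict (Ioc (0 : ℝ) 1))) volume := by
  have h1 : MeasurePreserving (Prod.map id ((↑) : ℝ → UnitAddCircle))
      ((volume : Measure (UnitAddTorus d)).prod (volume.restrict (Ioc (0 : ℝ) 1)))
      ((volume : Measure (UnitAddTorus d)).prod (volume : Measure UnitAddCircle)) := by
    have h := UnitAddCircle.measurePreserving_mk 0
    rw [zero_add] at h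
    exact (MeasurePreserving.id volume).prod h
  have h2 := measurePreserving_add_single_prod (d := d) p
  have heq : (fun z : UnitAddTorus d × ℝ => z.1 + Pi.single p ((z.2 : ℝ) : UnitAddCircle)) =
      (fun q : UnitAddTorus d × UnitAddCircle => q.1 + Pi.single p q.2) ∘
        Prod.map id ((↑) : ℝ → UnitAddCircle) := by
    funext z; rfl
  rw [heq]
  exact h2.comp h1

/-- An integrable function read along the shear is integrable on `T^d × (0, 1]`. [folklore] -/
theorem integrable_comp_add_single_prod {f : UnitAddTorus d → F} (hf : Integrable f volume) (p : d) :
    Integrable (fun z : UnitAddTorus d × ℝ => f (z.1 + Pi.single p ((z.2 : ℝ) : UnitAddCircle)))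
      ((volume : Measure (UnitAddTorus d)).prod (volume.restrict (Ioc (0 : ℝ) 1))) :=
  (measurePreserving_add_single_coe p).integrable_comp_of_integrable hf

/-- **Line restrictions of an `L¹` function are locally integrable for a.e. base point**: for
`f ∈ L¹(T^d)` and a.e. `x`, the `1`-periodic function `τ ↦ f(x + τ𝐞ₚ)` is integrable on every
bounded interval (Fubini through the shear for one period, then periodicity). [folklore] -/
theorem ae_intervalIntegrable_comp_add_single {f : UnitAddTorus d → F} (hf : Integrable f volume)
    (p : d) :
    ∀ᵐ x ∂(volume : Measure (UnitAddTorus d)), ∀ a b : ℝ,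
      IntervalIntegrable (fun τ : ℝ => f (x + Pi.single p ((τ : ℝ) : UnitAddCircle))) volume a b := by
  filter_upwards [(integrable_comp_add_single_prod hf p).prod_right_ae] with x hx
  have h01 : IntervalIntegrable (fun τ : ℝ => f (x + Pi.single p ((τ : ℝ) : UnitAddCircle)))
      volume 0 1 := by
    rw [intervalIntegrable_iff_integrableOn_Ioc_of_le zero_le_one]
    exact hx
  exact (periodic_comp_add_single f p x).intervalIntegrable₀ one_ne_zero h01

end Shear

/-! ## Fourier coefficients of weighted line averages -/

section LineAverage

variable {F : Type*} [NormedAddCommGroup F] [NormedSpace ℂ F]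

/-- The weighted shear integrand `(x, τ) ↦ w(τ) • f(x + τ𝐞ₚ)` is integrable on `T^d × (0, 1]` for
`f ∈ L¹(T^d)` and continuous `w`. [folklore] -/
theorem integrable_smul_comp_add_single_prod {f : UnitAddTorus d → F} (hf : Integrable f volume)
    (p : d) {w : ℝ → ℂ} (hw : Continuous w) :
    Integrable (fun z : UnitAddTorus d × ℝ => w z.2 • f (z.1 + Pi.single p ((z.2 : ℝ) : UnitAddCircle)))
      ((volume : Measure (UnitAddTorus d)).prod (volume.restrict (Ioc (0 : ℝ) 1))) := by
  obtain ⟨C, hC⟩ := isCompact_Icc.exists_bound_of_continuousOn (hw.continuousOn (s := Icc (0 : ℝ) 1))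
  have hae : ∀ᵐ z ∂((volume : Measure (UnitAddTorus d)).prod (volume.restrict (Ioc (0 : ℝ) 1))),
      ‖w z.2‖ ≤ C := by
    have h2 : ∀ᵐ z ∂((volume : Measure (UnitAddTorus d)).prod (volume.restrict (Ioc (0 : ℝ) 1))),
        z.2 ∈ Ioc (0 : ℝ) 1 :=
      (Measure.quasiMeasurePreserving_snd (μ := (volume : Measure (UnitAddTorus d)))
        (ν := volume.restrict (Ioc (0 : ℝ) 1))).ae (ae_restrict_mem measurableSet_Ioc)
    filter_upwards [h2] with z hz
    exact hC z.2 (Ioc_subset_Icc_self hz)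
  exact (integrable_comp_add_single_prod hf p).bdd_smul C
    (hw.comp_aestronglyMeasurable measurable_snd.aestronglyMeasurable) hae

/-- **Weighted line averages of `L¹` functions are integrable**:
`x ↦ ∫₀¹ w(τ) • f(x + τ𝐞ₚ) dτ ∈ L¹(T^d)` for `f ∈ L¹(T^d)`, `w` continuous. [folklore] -/
theorem integrable_lineAvg {f : UnitAddTorus d → F} (hf : Integrable f volume) (p : d) {w : ℝ → ℂ}
    (hw : Continuous w) :
    Integrable (fun x : UnitAddTorus d => ∫ τ in (0 : ℝ)..1, w τ • f (x + Pi.single p ((τ : ℝ) : UnitAddCircle)))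
      volume := by
  have h := (integrable_smul_comp_add_single_prod hf p hw).integral_prod_left
  refine h.congr (ae_of_all _ fun x => ?_)
  simp only [intervalIntegral.integral_of_le zero_le_one]

/-- **Fourier coefficients of a weighted line average**: for `f ∈ L¹(T^d; F)`, `w : ℝ → ℂ`
continuous and `n ∈ ℤ^d`,
`𝓕(x ↦ ∫₀¹ w(τ) • f(x + τ𝐞ₚ) dτ)(n) = (∫₀¹ w(τ) e^{2πi nₚ τ} dτ) • f̂(n)`
(Fubini, then `𝓕(f(· + τ𝐞ₚ))(n) = e^{2πi nₚτ} f̂(n)`, Grafakos 2014, Prop. 3.1.2 (5)).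
[cite: Grafakos2014, Prop. 3.1.2 (5)] -/
theorem mFourierCoeff_lineAvg [CompleteSpace F] {f : UnitAddTorus d → F} (hf : Integrable f volume)
    (p : d) {w : ℝ → ℂ} (hw : Continuous w) (n : d → ℤ) :
    mFourierCoeff (fun x : UnitAddTorus d => ∫ τ in (0 : ℝ)..1, w τ • f (x + Pi.single p ((τ : ℝ) : UnitAddCircle))) n =
      (∫ τ in (0 : ℝ)..1, w τ * fourier (n p) ((τ : ℝ) : UnitAddCircle)) • mFourierCoeff f n := by
  set μ : Measure (UnitAddTorus d × ℝ) :=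
    (volume : Measure (UnitAddTorus d)).prod (volume.restrict (Ioc (0 : ℝ) 1)) with hμ
  have hW := integrable_smul_comp_add_single_prod hf p hw
  -- the integrand against the character is integrable on the product
  have hG : Integrable (fun z : UnitAddTorus d × ℝ => mFourier (-n) z.1 •
      (w z.2 • f (z.1 + Pi.single p ((z.2 : ℝ) : UnitAddCircle)))) μ :=
    hW.bdd_smul 1 ((mFourier (-n)).continuous.comp_aestronglyMeasurable
      measurable_fst.aestronglyMeasurable)
      (ae_of_all _ fun z => ((mFourier (-n)).norm_coe_le_norm z.1).trans_eq mFourier_norm)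
  rw [mFourierCoeff_eq_integral_volume]
  simp only [intervalIntegral.integral_of_le zero_le_one]
  calc ∫ x, mFourier (-n) x • ∫ τ in Ioc (0 : ℝ) 1, w τ • f (x + Pi.single p ((τ : ℝ) : UnitAddCircle))
      = ∫ x, ∫ τ in Ioc (0 : ℝ) 1,
          mFourier (-n) x • (w τ • f (x + Pi.single p ((τ : ℝ) : UnitAddCircle))) := by
        refine integral_congr_ae (ae_of_all _ fun x => ?_)
        exact (MeasureTheory.integral_smul _ _).symm
    _ = ∫ τ in Ioc (0 : ℝ) 1, ∫ x,
          mFourier (-n) x • (w τ • f (x + Pi.single p ((τ : ℝ) : UnitAddCircle))) :=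
        integral_integral_swap hG
    _ = ∫ τ in Ioc (0 : ℝ) 1, (w τ * fourier (n p) ((τ : ℝ) : UnitAddCircle)) • mFourierCoeff f n := by
        refine integral_congr_ae (ae_of_all _ fun τ => ?_)
        have h1 : ∫ x, mFourier (-n) x • (w τ • f (x + Pi.single p ((τ : ℝ) : UnitAddCircle))) =
            w τ • mFourierCoeff (fun x => f (x + Pi.single p ((τ : ℝ) : UnitAddCircle))) n := by
          rw [mFourierCoeff_eq_integral_volume, ← MeasureTheory.integral_smul]
          refine integral_congr_ae (ae_of_all _ fun x => ?_)
          exact smul_comm _ _ _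
        simp only
        rw [h1, mFourierCoeff_comp_add_single, smul_smul]
    _ = (∫ τ in Ioc (0 : ℝ) 1, w τ * fourier (n p) ((τ : ℝ) : UnitAddCircle)) • mFourierCoeff f n :=
        _root_.integral_smul_const _ _

/-- `∫₀¹ e^{2πimτ} dτ = 𝟙[m = 0]`. [folklore] -/
theorem intervalIntegral_fourier_coe (m : ℤ) :
    ∫ τ in (0 : ℝ)..1, fourier m ((τ : ℝ) : UnitAddCircle) = if m = 0 then 1 else 0 := by
  by_cases hm : m = 0
  · subst hm
    simp only [fourier_zero, intervalIntegral.integral_const, sub_zero, one_smul, if_true]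
  · rw [if_neg hm]
    set c : ℂ := 2 * Real.pi * I * m / (1 : ℝ) with hc
    have hc0 : c ≠ 0 := by
      simp only [hc, Complex.ofReal_one, div_one]
      exact mul_ne_zero (mul_ne_zero (mul_ne_zero two_ne_zero (ofReal_ne_zero.2 Real.pi_pos.ne'))
        I_ne_zero) (Int.cast_ne_zero.2 hm)
    have hderiv : ∀ τ ∈ uIcc (0 : ℝ) 1, HasDerivAt (fun y : ℝ => fourier m ((y : ℝ) : UnitAddCircle) / c)
        (fourier m ((τ : ℝ) : UnitAddCircle)) τ := by
      intro τ _
      have h := (hasDerivAt_fourier 1 m τ).div_const c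
      rw [← hc, mul_div_cancel_left₀ _ hc0] at h
      exact h
    have hint : IntervalIntegrable (fun τ : ℝ => fourier m ((τ : ℝ) : UnitAddCircle)) volume 0 1 :=
      ((map_continuous (fourier m)).comp continuous_quotient_mk').intervalIntegrable _ _
    rw [integral_eq_sub_of_hasDerivAt hderiv hint]
    have h1 : ((1 : ℝ) : UnitAddCircle) = 0 := AddCircle.coe_period 1
    simp only [h1, AddCircle.coe_zero, fourier_eval_zero, sub_self]

/-- `2πim ∫₀¹ τ e^{2πimτ} dτ = 1` for `m ≠ 0`, i.e. `∫₀¹ τ e^{2πimτ} dτ = (2πim)⁻¹`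
(the primitive is `(τ/c - 1/c²) e^{cτ}`, `c = 2πim`). [folklore] -/
theorem intervalIntegral_coe_mul_fourier_coe {m : ℤ} (hm : m ≠ 0) :
    ∫ τ in (0 : ℝ)..1, ((τ : ℝ) : ℂ) * fourier m ((τ : ℝ) : UnitAddCircle) =
      1 / (2 * Real.pi * I * m) := by
  set c : ℂ := 2 * Real.pi * I * m / (1 : ℝ) with hc
  have hc1 : c = 2 * Real.pi * I * m := by simp only [hc, Complex.ofReal_one, div_one]
  have hc0 : c ≠ 0 := by
    rw [hc1]
    exact mul_ne_zero (mul_ne_zero (mul_ne_zero two_ne_zero (ofReal_ne_zero.2 Real.pi_pos.ne'))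
      I_ne_zero) (Int.cast_ne_zero.2 hm)
  have hderiv : ∀ τ ∈ uIcc (0 : ℝ) 1,
      HasDerivAt (fun y : ℝ => (((y : ℝ) : ℂ) / c - 1 / c ^ 2) * fourier m ((y : ℝ) : UnitAddCircle))
        (((τ : ℝ) : ℂ) * fourier m ((τ : ℝ) : UnitAddCircle)) τ := by
    intro τ _
    have h1 : HasDerivAt (fun y : ℝ => ((y : ℝ) : ℂ) / c - 1 / c ^ 2) (1 / c) τ := by
      have h := ((hasDerivAt_id τ).ofReal_comp.div_const c).sub_const (1 / c ^ 2)
      simpa using h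
    have h2 := h1.mul (hasDerivAt_fourier 1 m τ)
    have heq : 1 / c * fourier m ((τ : ℝ) : UnitAddCircle) +
        (((τ : ℝ) : ℂ) / c - 1 / c ^ 2) * (2 * Real.pi * I * m / (1 : ℝ) * fourier m ((τ : ℝ) : UnitAddCircle)) =
        ((τ : ℝ) : ℂ) * fourier m ((τ : ℝ) : UnitAddCircle) := by
      rw [← hc]
      field_simp
      ring
    rw [heq] at h2
    exact h2
  have hint : IntervalIntegrable (fun τ : ℝ => ((τ : ℝ) : ℂ) * fourier m ((τ : ℝ) : UnitAddCircle))
      volume 0 1 :=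
    (continuous_ofReal.mul ((map_continuous (fourier m)).comp continuous_quotient_mk')).intervalIntegrable _ _
  rw [integral_eq_sub_of_hasDerivAt hderiv hint]
  have h1 : ((1 : ℝ) : UnitAddCircle) = 0 := AddCircle.coe_period 1
  simp only [h1, AddCircle.coe_zero, fourier_eval_zero, mul_one, Complex.ofReal_one,
    Complex.ofReal_zero, zero_div, zero_sub]
  rw [← hc1]
  field_simp
  ring

end LineAverage

end Torus

end Literature.Analysis.FunctionSpaces

end
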